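import Mathlib
import HarnessLib
import Summits.Parity.Statement
import Summits.Parity.GeneralizedHardyLittlewood.Theses.GhostBoundaryCarving

/-!
# Assembly of route-Parity-GhostBoundaryCarving (item stmt-Parity-29352)

`Assembly : BoundedSiegelZeroQuality → FixedUpper → UniformUpperGivenFixed → TwoOfThree → PairLift →
UniformLowerGivenFixed → GeneralizedHardyLittlewood` is literally the route's certified deciding theorem
`closes` (node G1.2.L «GhostBoundaryCarving», decomp-parity lens-6 g4: the record's fixed-pattern lower leaf
carved at the parity-ghost threshold boundary as DHL[3,2] ∧ (DHL[3,2] → FixedLower); rev 0).  One line; no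
mathematics beyond the route file.
-/

namespace Summit.Parity.GeneralizedHardyLittlewood.Theses.GhostBoundaryCarving

/-- Assembly item stmt-Parity-29352 of route-Parity-GhostBoundaryCarving:
`BoundedSiegelZeroQuality → FixedUpper → UniformUpperGivenFixed → TwoOfThree → PairLift →
UniformLowerGivenFixed → GeneralizedHardyLittlewood`, by the route's deciding theorem `closes`. -/
theorem assembly_proof : Assembly :=
  fun h1 h2 h3 h4 h5 h6 => closes h1 h2 h3 h4 h5 h6

end Summit.Parity.GeneralizedHardyLittlewood.Theses.GhostBoundaryCarving
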